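import Summits.KontsevichZagierPeriods.KontsevichZagierPeriods.Theorems.LiouvilleUnfoldingAyoubPiLocalKernelRing
import Summits.KontsevichZagierPeriods.KontsevichZagierPeriods.Theorems.LiouvilleUnfoldingAyoubPiLocalKernel

/-!
# Line `SketchIdeator2` (card `nilradical-cut`) for crux stmt-KontsevichZagierPeriods-0541 `AyoubPiLocalKernel`
# — the lead's registered skeleton

Over the commutative formal period ring `P := KZ.FormalPeriodRing = FormalRep ⧸ relations` with
`ϖ := KZ.toFormalPeriod (KZ.of KZ.piRep)` (the class of the disc `[π]`), the crux reads (landed, p136024,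
`piLocalKernel_iff_forall_evalP` + p135819 `ayoubPiLocalKernel_iff_piLocalKernel`):
`∀ x : P, evalP x = 0 → ∃ N, ϖ ^ N * x = 0`.  The line cuts it EXACTLY into

* `stub_nilLocalKernel` (transcendence half; the lead's stub): every class of value `0` is `ϖ`-locally
  NILPOTENT, `∃ N k, ϖ ^ N * x ^ (k + 1) = 0` — equivalently every prime of `P` avoiding `ϖ` contains
  `ker evalP` (`nilLocalKernel_iff_primes` in the ideator's sketch);
* `stub_locallyReducedOnTorsion` (transcendence-free half; delegated): `P[ϖ⁻¹]` has no nilpotents among the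
  `ϖ`-locally nil classes, `(∃ N k, ϖ ^ N * x ^ (k + 1) = 0) → ∃ N, ϖ ^ N * x = 0` — equivalent to
  `NilIsPiTorsion` (D1 child of crux stmt-3929 `ReducedPeriodRing`) and implied by item 3929 (`IsReduced P`).

Both stubs are stated in CLOSED FORM over tree declarations only (no skeleton-local definition enters a
registered signature).  `AyoubPiLocalKernel_of` concludes the route decl BY NAME from the two stubs; the cut is
exact (`ayoubPiLocalKernel_iff_stubs`), so neither stub is a strengthening a disprover could separate from the
crux, and both are implied by the summit (`stubs_of_summit`).

## Status after lead cycle 1 (2026-08-17)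

Landed (`--supports` stmt-0541, all ACCEPTED): p138233 `Theorems/LiouvilleUnfoldingAyoubPiLocalKernelNilCut`
(exact cut; (N) ↔ primes form; (N) ↔ `ker Ev = nilradical P[p⁻¹]`), p138353 `…PositivePoints` (every MONOTONE
real integration theory `P →+* ℝ` is `evalP`: (N) holds at all monotone real primes), p138593
`…StubLocallyReducedOnTorsion` (worker: (R) ↔ `IsReduced P[p⁻¹]` ↔ squares form ↔ `NilIsPiTorsion`; item 3929
⇒ (R)), p138786 `…NilForms` ((N) ↔ every minimal prime avoiding `p` is `ker evalP` ↔ generic ∧ irreducible;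
abstract models: (N), (R) independent over the bare interface), p138853 `…TransposedPairing` (Cramer instances
of the crux shape).  Stub status: `stub_locallyReducedOnTorsion` — stub-blocked on item stmt-3929
`ReducedPeriodRing` (IsReduced P ⇒ (R); (R) = 3929's D1 child `NilIsPiTorsion`); `stub_nilLocalKernel` — OPEN,
period-conjecture strength: it is "the evaluation point is a generic point of `Spec P` AND `Spec P[p⁻¹]` is
irreducible" (HMS Conj. 13.2.5 shape); proved sectors: monotone real points (p138353), dim ≤ 1 rational subgroup
(p124986, `N = k = 0`).  Disproof.lean (cdisprove cycle 1) confirms: no stub kill exists short of ¬Conjecture 1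
(`not_piLocalKernel_of_not_locallyReducedOnTorsion`, §6 shift-invariant criterion).

## Status after lead cycle 2 (continuation seat c1, 2026-08-17)

Line kept (same skeleton, same two stubs; PICKED.md continuation note).  Landed (`--supports` stmt-0541,
ACCEPTED): p140096 `Theorems/LiouvilleUnfoldingAyoubPiLocalKernelVolumeForm` — the VOLUME FORM of the crux
(`ayoubPiLocalKernel_iff_volumeForm`: two compact `ℚ`-semialgebraic bodies of equal volume are `ϖ`-locally
move-equivalent, the localised Cresson–Viu-Sos conjecture), the body trichotomy `P = B ∪ −B ∪ Tors_ϖ`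
(`ayoubPiLocalKernel_iff_trichotomy`; summit: `P = B ∪ −B ∪ {0}`, `summit_iff_body_trichotomy`), an `eval`-free
description of `ker evalP` (`evalP_eq_zero_iff_not_body`, `evalP_eq_zero_iff_forall_nat`: the value-kernel is
the set of infinitesimals of the body order), (N) in volume form (`nilLocalKernel_iff_volumeForm`) and the kill
shape in volume form (`not_ayoubPiLocalKernel_iff_exists_bodies`: a refutation = two equal-volume bodies
inequivalent after every disc thickening); p140134 `…ConstantsDisc` (worker W1:
`evalP_injective_on_constants_adjoin_piClass` — `evalP` is injective on `K₀[ϖ]`, `K₀` = classes of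
dimension-`0` representations, by Lindemann over the real algebraic numbers: the second unconditional sector of
(N), exponent `0`, after dim ≤ 1 / Baker); p140181 `…BoundedInvariants` (worker W2:
`additive_eq_mul_evalP_of_bounded` — an additive move-invariant `θ : P →+ ℝ` BOUNDED on bodies of volume `≤ 1`
is `θ 1 · evalP`, with `unbounded_of_ne_mul_evalP`: an `ℝ`-valued kill of the crux must be unbounded on small
bodies, sharpening "must change sign" of p138353); p140224 (submitted) `…VolumeFormDimOne`
(`volumeForm_dim_one`: the `d = 1` instance of the volume form holds with `N = 0`, from p124986).  Position of the
stubs unchanged: (N) OPEN — Ayoub Conj. 7 minus reducedness; in volume form its first open dimension is `d = 2`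
(bodies between two real algebraic graphs = real 1-periods; printed transcendence input Huber–Wüstholz 2022,
transfer of 1-motive relations into the four moves missing); (R) parked on item stmt-3929.

## Status after lead cycle 3 (continuation seat c2, 2026-08-17)

Line kept (same skeleton, same two registered stubs; PICKED.md c2 note).  No wave is possible: (N) is the open
conjecture and stays with the lead, (R) is blocked on stmt-3929.  Programme of the seat: the DIMENSION LADDER of the
crux.  Landed (`--supports` stmt-0541): p140977 `Theorems/LiouvilleUnfoldingAyoubPiLocalKernelVolumeDescent`
(registered stub `volumeDescent`: every integrand-`1` representation of dimension `m + 1` is, modulo relations, a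
`ℤ`-combination of representations of dimension `m` — cylindrical decomposition, rule (1), Newton–Leibniz down the
inner bands), p141910 `…RationalSections` (registered stub `equivalent_of_rational_sections`: UNCONDITIONAL planar
volume form, `N = 0`, for bodies with rational vertical sections — one Newton–Leibniz move + the Baker class), p141936
`…DimensionLadder`
(registered stub `piLocalKernel_dim_le_iff_volumeForm_succ`): for EVERY predicate `Q` on `P` and every `d`,
"`Q ⟦c⟧` for all value-`0` `c` generated in dimension `≤ d`" ⟺ "`Q (⟦K₁⟧ − ⟦K₂⟧)` for all equal-volume compact
bodies of `ℝ^{d+1}`" (graded Cresson–Viu-Sos; instances: the crux, the summit, stub (N); rungs harden with `d`;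
rung `d = 0` a theorem from the dimension-zero ring, giving the dimension-1 volume form Baker-free; rung `d = 1`:
planar bodies ⟺ Conjecture 1/7 on `F_{≤1}` = real 1-periods); p142169 `…RungOne` (registered stub
`kzKernel_dim_le_one_of_realOnePeriodRelations`): item stmt-10042 `SymplecticScissors.RealOnePeriodRelations`
(Huber–Wüstholz in real clothes, OPEN) ⟹ Conjecture 1 on `F_{≤1}` ⟹ the whole rung `d = 1` of this crux with
`N = 0`, through the CLOSED crux `PlanarCompiler` (stmt-10058); also `VolumeFormOffPlane → VolumeForm` for that
route.  Position of the stubs: unchanged and now graded — (N) rung 0 proved, rung 1 ⟸ stmt-10042, rungs `≥ 2`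
(2-dimensional algebraic integrands / volumes of `ℚ`-solids: `π²`, `ζ(3)`, products of 1-periods) of frame
strength with no named input; (R) parked on stmt-3929.

## Status after lead cycle 4 (continuation seat c3, 2026-08-17)

Line kept (same skeleton, same two registered stubs; PICKED.md c3 note).  No wave is possible (unchanged: (N) is
the open conjecture, (R) is blocked on stmt-3929).  Programme of the seat: the COMPLEX POINTS of `Spec P[ϖ⁻¹]` —
kernel-checking claim (3) of the card ("a refutation of (N) is a field-valued multiplicative integration theory,
WLOG `ℂ`-valued since `P` is countable").  Landed (`--supports` stmt-0541, ACCEPTED): p145536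
`Theorems/LiouvilleUnfoldingAyoubPiLocalKernelComplexPoints` — `countable_formalPeriodRing` (**`P` is countable**:
a representation is determined modulo relations by (domain, graph of the integrand), two `ℚ`-semialgebraic sets);
`exists_ringHom_complex_ker_eq_formalPeriodRing` (**every prime of `P` is the kernel of a ring homomorphism
`P →+* ℂ`**: prime quotients have characteristic `0` because positive integers are units of `P`, and countable
fields of characteristic `0` embed in `ℂ`); `isNilpotent_iff_forall_ringHom_complex_formalPeriodRing`;
`locallyNil_iff_isNilpotent_mul` (`ϖ`-locally nil ↔ `IsNilpotent (ϖ * x)`); registered stub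
`nilLocalKernel_iff_complexPoints`: **(N) ↔ every `θ : P →+* ℂ` with `θ ϖ ≠ 0` kills `ker evalP`**;
`ayoubPiLocalKernel_iff_complexPoints_and_locallyReduced` (the crux = that ∧ (R));
`not_nilLocalKernel_iff_exists_complexPoint` (a kill of (N) = one `θ : P →+* ℂ`, `θ ϖ ≠ 0`, and one value-`0`
class `x` with `θ x ≠ 0`); `summit_iff_sq_and_complexPoints` (the summit = statement of crux 3929 ∧ EVERY
`θ : P →+* ℂ` kills `ker evalP`).  p146506 `Theorems/LiouvilleUnfoldingAyoubPiLocalKernelTamePoints` — registered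
stub `complexPoint_eq_evalP_of_norm_bounded`: a complex point norm-bounded on bodies of volume `≤ 1`, or
non-negative real on compact bodies, IS the Lebesgue point `Complex.ofReal ∘ evalP` (transport of p140181 /
p138353); `complexPoint_wild_of_not_ker_le`: a complex point refuting (N) is unbounded on small bodies and
negative or non-real on some compact body.  Side remark for the disprover's open question §4(c) of
`Disproof.lean` (is rule (2) redundant?): it is DECIDED elsewhere in the tree —
`Summit.KontsevichZagierPeriods.Theorems.StuffleInKZ.Negative.covFreeRelations_lt_relations` (a coordinate swap is
not generated by rules (1)+(3); first-axis marginal / algebraic-shadow invariant) and `not_kernel_le_covFree`;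
the `[π]`-local version in the CoV-free calculus stays undecided (the shadow invariant, like any slot-0 tail
invariant, dies under one disc-prepending).  Position of the stubs: UNCHANGED — (N) open (Ayoub 2014 Conj. 7 minus
reducedness; now also: "the Lebesgue point is the generic point of the complex-analytic space of
`ℂ`-valued multiplicative four-move integration theories with non-zero disc"), (R) parked on stmt-3929.
Recommendation (fourth seat in a row): hold 0541 as a conjecture-grade leaf; an item for (N) does not exist.
-/

noncomputable section

set_option linter.dupNamespace false

open Literature.NumberTheory.Transcendental

namespace Summit.KontsevichZagierPeriods.KontsevichZagierPeriods.Cruxes.AyoubPiLocalKernel.NilradicalCut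

open Summit.KontsevichZagierPeriods.LiouvilleUnfolding.PiLocalKernelPosition
open Summit.KontsevichZagierPeriods.KontsevichZagierPeriods.Theses.LiouvilleUnfolding (AyoubPiLocalKernel)

/-! ## The two stubs (registered signatures) -/

/-- **Stub 1 — `NilLocalKernel` (transcendence half, lead).** Every formal period of value `0` is nilpotent
after inverting the disc: `ϖ ^ N * x ^ (k + 1) = 0` for some `N k`.  Prime form: every prime ideal `q` of
`P` with `ϖ ∉ q` contains `ker evalP`.  Summit-implied (`N = k = 0`).  OPEN — period-conjecture strength
(Ayoub2014 Conj. 7 minus reducedness of `P[ϖ⁻¹]`). -/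
theorem stub_nilLocalKernel :
    ∀ x : KZ.FormalPeriodRing, KZ.evalP x = 0 →
      ∃ N k : ℕ, KZ.toFormalPeriod (KZ.of KZ.piRep) ^ N * x ^ (k + 1) = 0 := by
  sorry

/-- **Stub 2 — `LocallyReducedOnTorsion` (transcendence-free half, delegated).** A `ϖ`-locally nilpotent
class is `ϖ`-power torsion.  Equivalent to `NilIsPiTorsion` (crux stmt-3929's D1 child), implied by
`IsReduced P` (item stmt-3929 `ReducedPeriodRing`) and by `IsReduced (Localization.Away ϖ)`; motivic shadow:
Cartier smoothness of the localised torsor (HuberMullerStachPeriods2017 Rem. 13.2.4).  OPEN for the four-move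
calculus. -/
theorem stub_locallyReducedOnTorsion :
    ∀ x : KZ.FormalPeriodRing,
      (∃ N k : ℕ, KZ.toFormalPeriod (KZ.of KZ.piRep) ^ N * x ^ (k + 1) = 0) →
        ∃ N : ℕ, KZ.toFormalPeriod (KZ.of KZ.piRep) ^ N * x = 0 := by
  sorry

/-! ## Exactness of the cut (proved) -/

/-- Soundness in `P`, nil form: `ϖ ^ N * x ^ (k + 1) = 0` forces `evalP x = 0` (`evalP` is a ring map to the
domain `ℝ`, `evalP ϖ = π ≠ 0`). [folklore] -/
theorem evalP_eq_zero_of_pow_mul_pow_succ_eq_zero {x : KZ.FormalPeriodRing} {N k : ℕ}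
    (h : KZ.toFormalPeriod (KZ.of KZ.piRep) ^ N * x ^ (k + 1) = 0) : KZ.evalP x = 0 := by
  have h' := evalP_eq_zero_of_pow_mul_eq_zero h
  rw [map_pow] at h'
  exact (pow_eq_zero_iff (Nat.succ_ne_zero k)).mp h'

/-- **The cut is exact**: the route decl of item 0541 holds iff both stub statements hold. `→`: the torsion
form gives the nil form with `k = 0`, and a `ϖ`-locally nil class has value `0` (soundness), so the crux
applies to it. `←`: compose. [folklore] -/
theorem ayoubPiLocalKernel_iff_stubs :
    AyoubPiLocalKernel ↔
      ((∀ x : KZ.FormalPeriodRing, KZ.evalP x = 0 →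
          ∃ N k : ℕ, KZ.toFormalPeriod (KZ.of KZ.piRep) ^ N * x ^ (k + 1) = 0) ∧
        (∀ x : KZ.FormalPeriodRing,
          (∃ N k : ℕ, KZ.toFormalPeriod (KZ.of KZ.piRep) ^ N * x ^ (k + 1) = 0) →
            ∃ N : ℕ, KZ.toFormalPeriod (KZ.of KZ.piRep) ^ N * x = 0)) := by
  rw [ayoubPiLocalKernel_iff_piLocalKernel, piLocalKernel_iff_forall_evalP]
  constructor
  · intro h
    refine ⟨fun x hx => ?_, fun x ⟨N, k, hNk⟩ => h x (evalP_eq_zero_of_pow_mul_pow_succ_eq_zero hNk)⟩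
    obtain ⟨N, hN⟩ := h x hx
    exact ⟨N, 0, by rw [zero_add, pow_one]; exact hN⟩
  · rintro ⟨hnil, hred⟩ x hx
    exact hred x (hnil x hx)

/-- Both stubs are consequences of the summit (so neither is refutable short of refuting the Kontsevich–Zagier
period conjecture). [folklore] -/
theorem stubs_of_summit (h : KontsevichZagierPeriods) :
    (∀ x : KZ.FormalPeriodRing, KZ.evalP x = 0 →
        ∃ N k : ℕ, KZ.toFormalPeriod (KZ.of KZ.piRep) ^ N * x ^ (k + 1) = 0) ∧
      (∀ x : KZ.FormalPeriodRing,
        (∃ N k : ℕ, KZ.toFormalPeriod (KZ.of KZ.piRep) ^ N * x ^ (k + 1) = 0) →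
          ∃ N : ℕ, KZ.toFormalPeriod (KZ.of KZ.piRep) ^ N * x = 0) :=
  ayoubPiLocalKernel_iff_stubs.mp (ayoubPiLocalKernel_of_summit h)

/-! ## Composition: the crux by name -/

/-- **The line's deciding step**: the two stubs prove the route decl `AyoubPiLocalKernel` of item
stmt-KontsevichZagierPeriods-0541 BY NAME. [folklore] -/
theorem AyoubPiLocalKernel_of : AyoubPiLocalKernel :=
  ayoubPiLocalKernel_iff_stubs.mpr ⟨stub_nilLocalKernel, stub_locallyReducedOnTorsion⟩

/-- The same conclusion for route AyoubSpecialisation's decl of the shared item stmt-0541 (identical body,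
`Iff.rfl`), in the `<Crux>_proof` shape the skeleton check expects. [folklore] -/
theorem AyoubPiLocalKernel_proof :
    Summit.KontsevichZagierPeriods.KontsevichZagierPeriods.Theses.AyoubSpecialisation.AyoubPiLocalKernel :=
  ayoubPiLocalKernel_iff_ayoubSpecialisation.mp AyoubPiLocalKernel_of

end Summit.KontsevichZagierPeriods.KontsevichZagierPeriods.Cruxes.AyoubPiLocalKernel.NilradicalCut

end
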